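import Summits.QuantumFields.YangMills.Theorems.BalabanUVNodesN15CurvedPerturbationLettersOfCplx337UN
import HarnessLib

/-!
# Route «BalabanUVNodes» (cluster K4 «SpineRates»), Track-A DAG node N15 = NE2, BACKGROUND LAYER — PRINT's JOINT CLASS «U satisfies (3.35), A′ satisfies (3.37)» IN THE CUBE's GAUGE:
# the (3.37) class is an ORBIT STATEMENT in the pair `(U, A′) ↦ (U^u, R(u)A′)` («(R(u)U′)·U^u = (U′U)^u», (3.29)), so in the (3.35) gauge `u` of the cube BOTH perturbation letters of the
# device hold at once — the background's species around the flat base point (FILE 1) AND n15-w3's curved species of the rotated perturbation around the transformed background (FILE 2)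
# — for a `U(n)`-valued `U` and a Hermitian `A′`, from the two classes BY NAME and nothing else

Cell `pub-ymgap`, seat `pub-ymgap-dag-n15-w2` (WIDTH SEAT 2∕3 on node N15, director-ym №197 ∕ HUMAN RULING D-0149), g6, fourth piece (bus CLAIM-4).  `bears_on: R4∕N15 · K3⁸
SpineGivenEndpointR13SepCoPHV (stmt-QuantumFields-27366)`.  Filed `--kind proof --supports stmt-QuantumFields-27366 --as helper` — COUNT-NEUTRAL.  Theorems only; 0 `def`, 0 `sorry`.
Imports BY NAME this seat's g6 FILE 2 `…CurvedPerturbationLettersOfCplx337UN` (`uN_hasMaj_curvSpecies_rate_of_cplx337_shape`, `uN_fluct_mem_unitaryGroup_of_isHermitian`; through it FILE 1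
`uN_hasMaj_localSpecies_rate_of_gauge335`, `uN_opLetters_of_gauge335`, `uN_val_gaugeTr_eq`, `uN_val_inv_eq_conjTranspose`, lit-balaban r06 `B9Eq335RegularityClasses` (`Reg335Cube`,
`Cplx337`, `Cplx337Own`), `B9Eq3117Current` (`gaugeTr`, `rotB`, `rotS`, ★ `covD_gaugeTr`, ★ `prodCfg_gaugeTr`), `B9Eq39Adjoint` (`R`, `covD`, `fluct`, `prodCfg`)); nothing in the tree
is modified, no landed name re-declared.

WHY.  [Balaban1985BackgroundPropagators] p. 396 types the perturbed configurations as «U′U, where U has values in G and U′ = e^{iηA′} … U satisfies the condition (3.35), and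
|A′| < α₁(Lʲη)⁻¹, |∇^η_U A′| < α₁(Lʲη)⁻² on Ω_j» and p. 398 adds «All these inequalities are invariant with respect to gauge transformations of U»; the mechanism is (3.29)–(3.31)
p. 395: «A^η(R(u)U′U^u) = A^η((U′U)^u)», `D_{U^u}(R(u)f) = R(u)D_U f`.  The per-cube device of this lineage works IN THE CUBE's (3.35) GAUGE `u`: there the background is `U^u = e^{iηA}`
(small: FILE 1) and the perturbation becomes the ROTATED one `R(u)U′ = e^{iηR(u)A′}` around `U^u`.  FILE 2 served the (3.37) letters of `A′` relative to `U`; the device needs them for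
`R(u)A′` relative to `U^u` — which is the SAME statement by covariance.  THIS FILE types that and assembles the joint input:
* §1 (any normed ℂ-algebra) `norm_R_le_of_unitaryType` (`‖vXv⁻¹‖ ≤ ‖X‖`), `rotB_eq_rotS`, ★ `cplx337_shape_gaugeTr` (the two (3.37) letters at one scale pass from `(U, A′)` to
  `(U^u, R(u)A′)` at every site where `u` is of unitary type — r06 `covD_gaugeTr` + contraction), ★★ `cplx337_gaugeTr` ∕ `cplx337Own_gaugeTr` (r06's CLASSES (3.37), nested and own-level,
  are orbit statements in the pair — the (3.37) twin of n06-w3's `B9Eq336RegularityClassesOrbit` for (3.35)–(3.36)).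
* §2 (`𝔸 = M_n(ℂ)`, operator norm) `uN_rotB_conjTranspose` (`R(u)A′ = uA′uᴴ` stays Hermitian in a unitary gauge), `uN_gaugeTr_mem_unitaryGroup`, ★★
  `uN_exists_gauge_pairData_of_reg335Cube_cplx337_shape` — `U(n)`-valued `U ∈ Reg335Cube τ U η univ ξ C`, Hermitian `A′` with the (3.37) letters relative to `U` at scale `ξ′` ⟹ ∃ UNITARY
  `u` with: the background letters of `U^u` (FILE 1), `U^u ∈ U(n)`, `R(u)A′` Hermitian with the (3.37) letters relative to `U^u` at the same `(α, ξ′)`, and (3.29)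
  `e^{iηR(u)A′}·U^u = (e^{iηA′}·U)^u` (r06 `prodCfg_gaugeTr`).
* §3 ★★★ **`uN_exists_gauge_hasMaj_pair_of_reg335Cube_cplx337_shape`** — THE JOINT JUNCTION: under the same hypotheses (`η, ξ, ξ′ > 0`, `C, α ≥ 0`, `d(y,y) = 0`) there is a unitary `u`
  such that (a) the species of `U^u` around the flat base point obeys g5 FILE 11's `hV` with `a_R = √|n|(C∕ξ)e^{ηC∕ξ}`, `b_R = √|n|(C∕ξ²)e^{ηC∕ξ}` (FILE 1), (b) n15-w3's CURVED species
  `V̂_{R^u}(S^u)` of the rotated perturbation around the transformed background obeys g5 FILE 2's `hV` with `a_S = √|n|(α∕ξ′)e^{ηα∕ξ′}`, `b_S = √|n|(α∕ξ′²)e^{ηα∕ξ′}` (FILE 2 at the pair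
  `(R(u)A′, U^u)`), (c) (3.29).  BOTH routes' displayed letters DISCHARGED from the joint class; the classes remain the hypotheses, as in [B9] Thms 3.1 ∕ 3.4.

HONEST FRAMING ∕ LIMITS.  Gauge-covariance bookkeeping over r06's Literature predicates WITH BODY + the two junction files; REAL points only (Hermitian `A′`); the (3.37) letters are
taken at ONE scale `ξ′` (the by-name readings on `Ω_j` are FILE 2's `pertLetters_of_cplx337(Own)` and §1's orbit theorems); constants crude (`√|n|`); the knit (restriction to cube
windows, the two-grid pairing, the dressed rows) is the consumers'.  Nothing of [B5]∕[B6]∕[B9] asserted beyond cited shapes; NE2⁺ NOT PRINTED ∕ NOT proved; N15 NOT discharged; K3⁸ OPEN,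
skeleton v6 untouched (0∕2); counts of record UNMOVED (typed 28∕28 · discharged 5∕27 · A 5∕28); one finite 𝕋⁴ at fixed ε — NOT ℝ⁴ ∕ OS ∕ mass gap ∕ Clay; R4 closes the conditional
finite-𝕋⁴ rung `BalabanLadder.UV` only.  Restate-immune (no Theses import).
-/

set_option autoImplicit false

noncomputable section
open scoped BigOperators Matrix

namespace Summit.QuantumFields.YangMills.BalabanUVNodes.N15.CurvedSpecies

/-! ## §1 The class (3.37) is an orbit statement in the pair `(U, A′)` — «A^η(R(u)U′U^u) = A^η((U′U)^u)» (any complete normed ℂ-algebra) -/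

section Generic

open Literature.MathematicalPhysics.QuantumFieldTheory.Balaban1983to89
open Literature.MathematicalPhysics.QuantumFieldTheory.Balaban1983to89.B9Eq39Adjoint (R covD fluct prodCfg)
open Literature.MathematicalPhysics.QuantumFieldTheory.Balaban1983to89.B9Eq3117Current (gaugeTr rotB rotS covD_gaugeTr prodCfg_gaugeTr)
open Literature.MathematicalPhysics.QuantumFieldTheory.Balaban1983to89.B9Eq335RegularityClasses (Cplx337 Cplx337Own OnOmega)

variable {𝔸 : Type*} [NormedRing 𝔸] [NormedAlgebra ℂ 𝔸] {S ι : Type*} (T : ι → Equiv.Perm S) (U : ι → S → 𝔸ˣ)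

omit [NormedAlgebra ℂ 𝔸] in
/-- The rotation `R(v)X = vXv⁻¹` by a unit of unitary type does not increase the norm. [cite: Balaban1985BackgroundPropagators, p.395 («R(u)A»), p.398 («invariant with respect to gauge transformations»)] -/
theorem norm_R_le_of_unitaryType {v : 𝔸ˣ} (hv : ‖(v : 𝔸)‖ ≤ 1 ∧ ‖(((v⁻¹ : 𝔸ˣ)) : 𝔸)‖ ≤ 1) (X : 𝔸) : ‖R v X‖ ≤ ‖X‖ := by
  rw [B9Eq39Adjoint.R_def]
  calc ‖(v : 𝔸) * X * (((v⁻¹ : 𝔸ˣ)) : 𝔸)‖ ≤ ‖(v : 𝔸)‖ * ‖X‖ * ‖(((v⁻¹ : 𝔸ˣ)) : 𝔸)‖ :=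
        (norm_mul_le _ _).trans (mul_le_mul_of_nonneg_right (norm_mul_le _ _) (norm_nonneg _))
    _ ≤ 1 * ‖X‖ * 1 := by gcongr <;> [exact hv.1; exact hv.2]
    _ = ‖X‖ := by ring

omit [NormedAlgebra ℂ 𝔸] in
/-- The rotated bond field is the site-wise rotation of each component: `rotB u A′ ν = rotS u (A′ ν)`. [folklore] -/
theorem rotB_eq_rotS (u : S → 𝔸ˣ) (A' : ι → S → 𝔸) (ν : ι) : rotB u A' ν = rotS u (A' ν) := rfl

/-- ★ **THE (3.37) LETTERS AT ONE SCALE ARE GAUGE-COVARIANT IN THE PAIR**: if `A′` has `‖A′_ν(z)‖ < αξ⁻¹` and `‖η⁻¹(D¹_{U,κ}A′_ν)(z)‖ < α(ξ²)⁻¹` at `z`, and `u(z)` is of unitary type, then the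
ROTATED potential `R(u)A′` has the same two letters at `z` RELATIVE TO THE TRANSFORMED BACKGROUND `U^u` (`D_{U^u}(R(u)f) = R(u)D_U f`, r06 `covD_gaugeTr`; `‖R(u)X‖ ≤ ‖X‖`).
[cite: Balaban1985BackgroundPropagators, (3.29)–(3.31) p.395, (3.37) p.396, p.398 («All these inequalities are invariant with respect to gauge transformations of U»)] -/
theorem cplx337_shape_gaugeTr {η ξ α : ℝ} {u : S → 𝔸ˣ} {A' : ι → S → 𝔸} {κ ν : ι} {z : S} (hu : ‖(u z : 𝔸)‖ ≤ 1 ∧ ‖((((u z)⁻¹ : 𝔸ˣ)) : 𝔸)‖ ≤ 1)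
    (hA : ‖A' ν z‖ < α * ξ⁻¹) (hD : ‖((η : ℂ)⁻¹) • covD T U κ (A' ν) z‖ < α * (ξ ^ 2)⁻¹) :
    ‖rotB u A' ν z‖ < α * ξ⁻¹ ∧ ‖((η : ℂ)⁻¹) • covD T (gaugeTr T u U) κ (rotB u A' ν) z‖ < α * (ξ ^ 2)⁻¹ := by
  refine ⟨(norm_R_le_of_unitaryType hu _).trans_lt hA, ?_⟩
  rw [rotB_eq_rotS, covD_gaugeTr, ← B9Eq39Adjoint.R_smul]
  exact (norm_R_le_of_unitaryType hu _).trans_lt hD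

/-- ★★ **THE CLASS (3.37) IS AN ORBIT STATEMENT IN THE PAIR `(U, A′)`**: `Cplx337 T U η L lev α₁ A′` and `u` of unitary type everywhere ⟹ `Cplx337 T (U^u) η L lev α₁ (R(u)A′)` — the (3.37)
twin of the (3.35)–(3.36) orbit statements of `B9Eq336RegularityClassesOrbit`; by (3.29) `(R(u)U′)·U^u = (U′U)^u` (r06 `prodCfg_gaugeTr`) this is print's «All these inequalities are
invariant with respect to gauge transformations». [cite: Balaban1985BackgroundPropagators, (3.29) p.395, (3.37) p.396, p.398] -/
theorem cplx337_gaugeTr {η L : ℝ} {lev : S → ℕ} {α₁ : ℝ} {A' : ι → S → 𝔸} (h : Cplx337 T U η L lev α₁ A') {u : S → 𝔸ˣ}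
    (hu : ∀ z, ‖(u z : 𝔸)‖ ≤ 1 ∧ ‖((((u z)⁻¹ : 𝔸ˣ)) : 𝔸)‖ ≤ 1) : Cplx337 T (gaugeTr T u U) η L lev α₁ (rotB u A') :=
  ⟨fun j ν z hz => (norm_R_le_of_unitaryType (hu z) _).trans_lt (h.1 j ν z hz), fun j κ ν z hz => by
    rw [rotB_eq_rotS, covD_gaugeTr, ← B9Eq39Adjoint.R_smul]
    exact (norm_R_le_of_unitaryType (hu z) _).trans_lt (h.2 j κ ν z hz)⟩

/-- The own-level class likewise. [cite: Balaban1985BackgroundPropagators, (3.37) p.396, p.398] -/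
theorem cplx337Own_gaugeTr {η L : ℝ} {lev : S → ℕ} {α₁ : ℝ} {A' : ι → S → 𝔸} (h : Cplx337Own T U η L lev α₁ A') {u : S → 𝔸ˣ}
    (hu : ∀ z, ‖(u z : 𝔸)‖ ≤ 1 ∧ ‖((((u z)⁻¹ : 𝔸ˣ)) : 𝔸)‖ ≤ 1) : Cplx337Own T (gaugeTr T u U) η L lev α₁ (rotB u A') :=
  ⟨fun ν z => (norm_R_le_of_unitaryType (hu z) _).trans_lt (h.1 ν z), fun κ ν z => by
    rw [rotB_eq_rotS, covD_gaugeTr, ← B9Eq39Adjoint.R_smul]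
    exact (norm_R_le_of_unitaryType (hu z) _).trans_lt (h.2 κ ν z)⟩

end Generic

/-! ## §2 `𝔸 = M_n(ℂ)`: the joint class «U satisfies (3.35), A′ satisfies (3.37)» in the (3.35) gauge of the cube -/

section MatrixOp

open scoped Matrix.Norms.L2Operator
open Literature.MathematicalPhysics.QuantumFieldTheory.Balaban1983to89
open Literature.MathematicalPhysics.QuantumFieldTheory.Balaban1983to89.B9Eq39Adjoint (R covD fluct prodCfg)
open Literature.MathematicalPhysics.QuantumFieldTheory.Balaban1983to89.B9Eq3117Current (gaugeTr rotB rotS prodCfg_gaugeTr)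
open Literature.MathematicalPhysics.QuantumFieldTheory.Balaban1983to89.B9Eq335RegularityClasses (Reg335Cube)

variable {n : Type} [Fintype n] [DecidableEq n] [Nonempty n] {X J : Type} (τ : J → Equiv.Perm X) (V : J → X → (Matrix n n ℂ)ˣ)

omit [Nonempty n] in
/-- In a unitary gauge the rotated potential stays Hermitian: `(uA′uᴴ)ᴴ = uA′uᴴ` (print's «A′ ∈ 𝔤» is gauge invariant). [cite: Balaban1985BackgroundPropagators, p.395 («R(u)A»)] -/
theorem uN_rotB_conjTranspose {u : X → (Matrix n n ℂ)ˣ} (hu : ∀ x, (u x : Matrix n n ℂ) ∈ Matrix.unitaryGroup n ℂ) {A' : J → X → Matrix n n ℂ}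
    (hA : ∀ μ x, (A' μ x)ᴴ = A' μ x) (μ : J) (x : X) : (rotB u A' μ x)ᴴ = rotB u A' μ x := by
  rw [B9Eq3117Current.rotB_apply, B9Eq39Adjoint.R_def, uN_val_inv_eq_conjTranspose (hu x), Matrix.conjTranspose_mul, Matrix.conjTranspose_mul,
    Matrix.conjTranspose_conjTranspose, hA μ x, Matrix.mul_assoc]

omit [Nonempty n] in
/-- The transformed background is `U(n)`-valued when `U` and the gauge are. [folklore] -/
theorem uN_gaugeTr_mem_unitaryGroup {u : X → (Matrix n n ℂ)ˣ} (hu : ∀ x, (u x : Matrix n n ℂ) ∈ Matrix.unitaryGroup n ℂ)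
    (hV : ∀ μ x, (V μ x : Matrix n n ℂ) ∈ Matrix.unitaryGroup n ℂ) (μ : J) (x : X) :
    (gaugeTr τ u V μ x : Matrix n n ℂ) ∈ Matrix.unitaryGroup n ℂ := by
  rw [uN_val_gaugeTr_eq (T := τ) V (hu (τ μ x))]
  exact Submonoid.mul_mem _ (Submonoid.mul_mem _ (hu x) (hV μ x)) (Unitary.star_mem (hu (τ μ x)))

/-- ★★ **THE JOINT CLASS «U ∈ (3.35), A′ ∈ (3.37)» IN THE CUBE's GAUGE, `𝔸 = M_n(ℂ)`**: a `U(n)`-valued background `U` in `Reg335Cube τ U η univ ξ C` and a Hermitian `A′` with the two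
(3.37) letters RELATIVE TO `U` at the scale `ξ′` (`‖A′_μ‖_{op} < α·ξ′⁻¹`, `‖η⁻¹D¹_{U,μ}A′_ν‖_{op} < α·(ξ′²)⁻¹`), `η > 0` ⟹ there is a UNITARY gauge `u` (the class's own) such that, with `U^u`
and the ROTATED potential `R(u)A′ = uA′uᴴ`: (i) BACKGROUND LETTERS `‖U^u_κ(z) − 1‖ ≤ η(C∕ξ)e^{ηC∕ξ}`, `‖U^u_ν(z+e_κ) − U^u_ν(z)‖ ≤ η²(C∕ξ²)e^{ηC∕ξ}` (FILE 1); (ii) `U^u` is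
`U(n)`-valued and `R(u)A′` is Hermitian; (iii) `R(u)A′` has the two (3.37) letters relative to `U^u` at the same `(α, ξ′)` (§1); (iv) (3.29): `e^{iηR(u)A′}·U^u = (e^{iηA′}U)^u` — the pair
in the cube gauge IS the gauge transform of the pair (r06 `prodCfg_gaugeTr`). [cite: Balaban1985BackgroundPropagators, (3.29) p.395, (3.35)–(3.37) p.396, Cor. 3.6 p.408] -/
theorem uN_exists_gauge_pairData_of_reg335Cube_cplx337_shape {η : ℝ} (hη : 0 < η)
    (hV : ∀ μ x, (V μ x : Matrix n n ℂ) ∈ Matrix.unitaryGroup n ℂ) {ξ C : ℝ} (h : Reg335Cube τ V η Set.univ ξ C) {ξ' α : ℝ} {A' : J → X → Matrix n n ℂ}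
    (hA : ∀ μ x, (A' μ x)ᴴ = A' μ x) (hAα : ∀ μ x, ‖A' μ x‖ < α * ξ'⁻¹) (hD : ∀ μ ν x, ‖((η : ℂ)⁻¹) • covD τ V μ (A' ν) x‖ < α * (ξ' ^ 2)⁻¹) :
    ∃ u : X → (Matrix n n ℂ)ˣ, (∀ x, (u x : Matrix n n ℂ) ∈ Matrix.unitaryGroup n ℂ) ∧
      ((∀ κ z, ‖(gaugeTr τ u V κ z : Matrix n n ℂ) - 1‖ ≤ η * (C / ξ) * Real.exp (η * (C / ξ))) ∧
        ∀ κ ν z, ‖(gaugeTr τ u V ν (τ κ z) : Matrix n n ℂ) - gaugeTr τ u V ν z‖ ≤ η ^ 2 * (C / ξ ^ 2) * Real.exp (η * (C / ξ))) ∧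
      ((∀ μ x, (gaugeTr τ u V μ x : Matrix n n ℂ) ∈ Matrix.unitaryGroup n ℂ) ∧ ∀ μ x, (rotB u A' μ x)ᴴ = rotB u A' μ x) ∧
      ((∀ μ x, ‖rotB u A' μ x‖ < α * ξ'⁻¹) ∧ ∀ μ ν x, ‖((η : ℂ)⁻¹) • covD τ (gaugeTr τ u V) μ (rotB u A' ν) x‖ < α * (ξ' ^ 2)⁻¹) ∧
      prodCfg (gaugeTr τ u V) η (rotB u A') = gaugeTr τ u (prodCfg V η A') := by
  obtain ⟨u, A, hu1, hg, hAC, hDC⟩ := h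
  obtain ⟨huU, h1, h2⟩ := uN_opLetters_of_gauge335 (T := τ) V (cube := Set.univ) hη hu1 hg hAC hDC
  have hu : ∀ x, (u x : Matrix n n ℂ) ∈ Matrix.unitaryGroup n ℂ := fun x => huU x (Set.mem_univ x)
  refine ⟨u, hu, ⟨fun κ z => h1 κ z (Set.mem_univ z), fun κ ν z => h2 κ ν z (Set.mem_univ z) (Set.mem_univ _)⟩,
    ⟨uN_gaugeTr_mem_unitaryGroup τ V hu hV, uN_rotB_conjTranspose hu hA⟩,
    ⟨fun μ x => (cplx337_shape_gaugeTr τ V (κ := μ) (hu1 x (Set.mem_univ x)) (hAα μ x) (hD μ μ x)).1,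
      fun μ ν x => (cplx337_shape_gaugeTr τ V (hu1 x (Set.mem_univ x)) (hAα ν x) (hD μ ν x)).2⟩,
    prodCfg_gaugeTr τ V u η A'⟩

end MatrixOp

/-! ## §3 THE JOINT JUNCTION: both `hV` letters of the cube device at the LIVE pair, in the (3.35) gauge -/

section Junction

open scoped Matrix.Norms.L2Operator
open Literature.MathematicalPhysics.QuantumFieldTheory.Balaban1983to89
open Literature.MathematicalPhysics.QuantumFieldTheory.Balaban1983to89.B11SectG (BlockNorm HasMaj)
open Literature.MathematicalPhysics.QuantumFieldTheory.Balaban1983to89.B9Eq39Adjoint (R covD fluct prodCfg)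
open Literature.MathematicalPhysics.QuantumFieldTheory.Balaban1983to89.B9Eq3117Current (gaugeTr rotB prodCfg_gaugeTr)
open Literature.MathematicalPhysics.QuantumFieldTheory.Balaban1983to89.B9Eq335RegularityClasses (Reg335Cube Cplx337 OnOmega)
open Literature.MathematicalPhysics.QuantumFieldTheory.Balaban1983to89.LatticeNorms (scaleLen)
open Summit.QuantumFields.YangMills.BalabanUVNodes.N15.MatrixSpecies (liftBlk coordMat basisConst basisConst_nonneg)
open Summit.QuantumFields.YangMills.BalabanUVNodes.N15.BackgroundLayer (tCoefA tCoefC unstackM blkPair)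
open Literature.Barriers.QuantumFields (traceForm)

variable {n : Type} [Fintype n] [DecidableEq n] [Nonempty n] {κ : Type} [Fintype κ] [DecidableEq κ] (e : Matrix n n ℂ ≃L[ℝ] (κ → ℝ))
variable {X J : Type} [Fintype X] [Fintype J] (τ : J → X ≃ X) (V : J → X → (Matrix n n ℂ)ˣ)

/-- ★★★ **THE JOINT JUNCTION — PRINT's JOINT CLASS «U satisfies (3.35), A′ satisfies (3.37)» FEEDS BOTH PERTURBATION LETTERS OF THE CUBE DEVICE AT THE LIVE PAIR, IN THE CUBE's GAUGE.**
A `U(n)`-valued background `U` on the cube device's carrier in r06's class `Reg335Cube τ U η univ ξ C`, a Hermitian `A′` with the (3.37) letters relative to `U` at scale `ξ′`, `η, ξ, ξ′ > 0`,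
`C, α ≥ 0`, `d(y, y) = 0` ⟹ there is a UNITARY gauge `u` such that, writing `W_u = coordMat e (Ad_u)`, `R = coordMat e (Ad_U)`, `R^u = (R)^{W_u}` (the transporters of `U^u`),
`S^u` = the transporters of the rotated perturbation `e^{iηR(u)A′} = R(u)e^{iηA′}`:
(a) the species of the BACKGROUND around the flat base point in the cube gauge, `unstackM (tCoefC η Rp) (tCoefA η Rp)`, `Rp = gaugePair τ R^u`, obeys g5 FILE 11's `hV` with
`a_R := √|n|(C∕ξ)e^{ηC∕ξ}`, `b_R := √|n|(C∕ξ²)e^{ηC∕ξ}` (FILE 1 `uN_hasMaj_localSpecies_rate_of_gauge335`);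
(b) n15-w3's CURVED species `V̂_{R^u}(S^u) = unstackM (curvCoefC η τ R^u S^u) (curvCoefA η τ R^u S^u)` of the rotated perturbation around the transformed background obeys g5 FILE 2's `hV`
with `a_S := √|n|(α∕ξ′)e^{ηα∕ξ′}`, `b_S := √|n|(α∕ξ′²)e^{ηα∕ξ′}` (FILE 2 `uN_hasMaj_curvSpecies_rate_of_cplx337_shape` at the pair `(R(u)A′, U^u)`, legitimate by §2 (ii)–(iii));
(c) (3.29): `e^{iηR(u)A′}·U^u = (e^{iηA′}·U)^u`.  Both displayed letters of BOTH routes are DISCHARGED from the joint class; the classes remain the hypotheses, as in [B9] Thms 3.1∕3.4.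
[cite: Balaban1985BackgroundPropagators, (3.29) p.395, (3.35)–(3.37) p.396, Thm 3.1 p.397, Thm 3.4 p.400, (3.52)–(3.53) p.400, Cor. 3.6 p.408] -/
theorem uN_exists_gauge_hasMaj_pair_of_reg335Cube_cplx337_shape (he : ∀ A B : Matrix n n ℂ, traceForm A B = e A ⬝ᵥ e B) {g : B6.Geometry} (blk : X → g.Site)
    (hd0 : ∀ y : g.Site, g.dist y y = 0) {η : ℝ} (hη : 0 < η) (hV : ∀ μ x, (V μ x : Matrix n n ℂ) ∈ Matrix.unitaryGroup n ℂ) {ξ C : ℝ} (hξ : 0 < ξ) (hC : 0 ≤ C)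
    (h : Reg335Cube τ V η Set.univ ξ C) {ξ' α : ℝ} (hξ' : 0 < ξ') (hα : 0 ≤ α) {A' : J → X → Matrix n n ℂ} (hA : ∀ μ x, (A' μ x)ᴴ = A' μ x)
    (hAα : ∀ μ x, ‖A' μ x‖ < α * ξ'⁻¹) (hD : ∀ μ ν x, ‖((η : ℂ)⁻¹) • covD τ V μ (A' ν) x‖ < α * (ξ' ^ 2)⁻¹) (δV : ℝ) :
    ∃ u : X → (Matrix n n ℂ)ˣ, (∀ x, (u x : Matrix n n ℂ) ∈ Matrix.unitaryGroup n ℂ) ∧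
      HasMaj (BlockNorm.ofBlocks g (blkPair (liftBlk blk κ))) (BlockNorm.ofBlocks g (liftBlk blk κ))
        (unstackM (tCoefC η (gaugePair τ (trGaugeActFwd τ (fun x => coordMat e (ContinuousLinearMap.mulLeftRight ℝ (Matrix n n ℂ) (u x : Matrix n n ℂ) (u x : Matrix n n ℂ)ᴴ))
              (fun μ x => coordMat e (ContinuousLinearMap.mulLeftRight ℝ (Matrix n n ℂ) (V μ x : Matrix n n ℂ) (V μ x : Matrix n n ℂ)ᴴ)))))
          (tCoefA η (gaugePair τ (trGaugeActFwd τ (fun x => coordMat e (ContinuousLinearMap.mulLeftRight ℝ (Matrix n n ℂ) (u x : Matrix n n ℂ) (u x : Matrix n n ℂ)ᴴ))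
              (fun μ x => coordMat e (ContinuousLinearMap.mulLeftRight ℝ (Matrix n n ℂ) (V μ x : Matrix n n ℂ) (V μ x : Matrix n n ℂ)ᴴ))))))
        (fun y y' => curvRowLetter κ J
            (@basisConst κ _ (Matrix n n ℂ) Matrix.frobeniusNormedAddCommGroup Matrix.frobeniusNormedSpace e * (2 * Real.sqrt (Fintype.card n)) *
              (Real.sqrt (Fintype.card n) * ((C / ξ) * Real.exp (η * (C / ξ)))))
            (@basisConst κ _ (Matrix n n ℂ) Matrix.frobeniusNormedAddCommGroup Matrix.frobeniusNormedSpace e * (2 * Real.sqrt (Fintype.card n)) *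
              (Real.sqrt (Fintype.card n) * ((C / ξ ^ 2) * Real.exp (η * (C / ξ))))) * (1 + Fintype.card (J ⊕ J)) *
          Real.exp (-(δV * g.dist y y'))) ∧
      HasMaj (BlockNorm.ofBlocks g (blkPair (liftBlk blk κ))) (BlockNorm.ofBlocks g (liftBlk blk κ))
        (unstackM
          (curvCoefC η τ (fun μ x => coordMat e (ContinuousLinearMap.mulLeftRight ℝ (Matrix n n ℂ) (gaugeTr τ u V μ x : Matrix n n ℂ) (gaugeTr τ u V μ x : Matrix n n ℂ)ᴴ))
            (fun μ x => coordMat e (ContinuousLinearMap.mulLeftRight ℝ (Matrix n n ℂ) (fluct η (rotB u A') μ x : Matrix n n ℂ) (fluct η (rotB u A') μ x : Matrix n n ℂ)ᴴ)))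
          (curvCoefA η τ (fun μ x => coordMat e (ContinuousLinearMap.mulLeftRight ℝ (Matrix n n ℂ) (gaugeTr τ u V μ x : Matrix n n ℂ) (gaugeTr τ u V μ x : Matrix n n ℂ)ᴴ))
            (fun μ x => coordMat e (ContinuousLinearMap.mulLeftRight ℝ (Matrix n n ℂ) (fluct η (rotB u A') μ x : Matrix n n ℂ) (fluct η (rotB u A') μ x : Matrix n n ℂ)ᴴ))))
        (fun y y' => curvRowLetter κ J
            (@basisConst κ _ (Matrix n n ℂ) Matrix.frobeniusNormedAddCommGroup Matrix.frobeniusNormedSpace e * (2 * Real.sqrt (Fintype.card n)) *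
              (Real.sqrt (Fintype.card n) * ((α / ξ') * Real.exp (η * (α / ξ')))))
            (@basisConst κ _ (Matrix n n ℂ) Matrix.frobeniusNormedAddCommGroup Matrix.frobeniusNormedSpace e * (2 * Real.sqrt (Fintype.card n)) *
              (Real.sqrt (Fintype.card n) * ((α / ξ' ^ 2) * Real.exp (η * (α / ξ'))))) * (1 + Fintype.card (J ⊕ J)) *
          Real.exp (-(δV * g.dist y y'))) ∧
      prodCfg (gaugeTr τ u V) η (rotB u A') = gaugeTr τ u (prodCfg V η A') := by
  obtain ⟨u, A, hu1, hg, hAC, hDC⟩ := h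
  have hall : ∀ x, x ∈ (Set.univ : Set X) := Set.mem_univ
  obtain ⟨hu, hR⟩ := uN_hasMaj_localSpecies_rate_of_gauge335 e τ V he blk hd0 hη hV hξ hC (fun x => hu1 x (hall x)) (fun μ x => hg μ x (hall x))
    (fun μ x => hAC μ x (hall x)) (fun μ ν x => hDC μ ν x (hall x)) δV
  refine ⟨u, hu, hR, ?_, prodCfg_gaugeTr τ V u η A'⟩
  exact uN_hasMaj_curvSpecies_rate_of_cplx337_shape e τ (gaugeTr τ u V) he blk hd0 hη (uN_gaugeTr_mem_unitaryGroup τ V hu hV) hξ' hα (uN_rotB_conjTranspose hu hA)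
    (fun μ x => (cplx337_shape_gaugeTr τ V (κ := μ) (hu1 x (hall x)) (hAα μ x) (hD μ μ x)).1)
    (fun μ ν x => (cplx337_shape_gaugeTr τ V (hu1 x (hall x)) (hAα ν x) (hD μ ν x)).2) δV

/-- ★★★ **THE JOINT JUNCTION WITH THE (3.37) CLASS BY NAME**: as `uN_exists_gauge_hasMaj_pair_of_reg335Cube_cplx337_shape`, with the perturbation hypothesis read from r06's class
`Cplx337 τ U η L lev α₁ A′` on a carrier inside one domain `Ω_j` (`OnOmega lev j x` for every `x`), `ξ′ = Lʲη`, `L ≥ 1`, `α₁ ≥ 0`.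
[cite: Balaban1985BackgroundPropagators, (3.29) p.395, (3.35)–(3.37) p.396, (3.41) p.397, Thm 3.4 p.400] -/
theorem uN_exists_gauge_hasMaj_pair_of_reg335Cube_cplx337 (he : ∀ A B : Matrix n n ℂ, traceForm A B = e A ⬝ᵥ e B) {g : B6.Geometry} (blk : X → g.Site)
    (hd0 : ∀ y : g.Site, g.dist y y = 0) {η L : ℝ} (hη : 0 < η) (hL : 1 ≤ L) (hV : ∀ μ x, (V μ x : Matrix n n ℂ) ∈ Matrix.unitaryGroup n ℂ) {ξ C : ℝ} (hξ : 0 < ξ) (hC : 0 ≤ C)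
    (h : Reg335Cube τ V η Set.univ ξ C) {lev : X → ℕ} {α₁ : ℝ} (hα₁ : 0 ≤ α₁) {A' : J → X → Matrix n n ℂ} (hA : ∀ μ x, (A' μ x)ᴴ = A' μ x) (h37 : Cplx337 τ V η L lev α₁ A')
    {j : ℕ} (hΩ : ∀ x, OnOmega lev j x) (δV : ℝ) :
    ∃ u : X → (Matrix n n ℂ)ˣ, (∀ x, (u x : Matrix n n ℂ) ∈ Matrix.unitaryGroup n ℂ) ∧
      HasMaj (BlockNorm.ofBlocks g (blkPair (liftBlk blk κ))) (BlockNorm.ofBlocks g (liftBlk blk κ))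
        (unstackM (tCoefC η (gaugePair τ (trGaugeActFwd τ (fun x => coordMat e (ContinuousLinearMap.mulLeftRight ℝ (Matrix n n ℂ) (u x : Matrix n n ℂ) (u x : Matrix n n ℂ)ᴴ))
              (fun μ x => coordMat e (ContinuousLinearMap.mulLeftRight ℝ (Matrix n n ℂ) (V μ x : Matrix n n ℂ) (V μ x : Matrix n n ℂ)ᴴ)))))
          (tCoefA η (gaugePair τ (trGaugeActFwd τ (fun x => coordMat e (ContinuousLinearMap.mulLeftRight ℝ (Matrix n n ℂ) (u x : Matrix n n ℂ) (u x : Matrix n n ℂ)ᴴ))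
              (fun μ x => coordMat e (ContinuousLinearMap.mulLeftRight ℝ (Matrix n n ℂ) (V μ x : Matrix n n ℂ) (V μ x : Matrix n n ℂ)ᴴ))))))
        (fun y y' => curvRowLetter κ J
            (@basisConst κ _ (Matrix n n ℂ) Matrix.frobeniusNormedAddCommGroup Matrix.frobeniusNormedSpace e * (2 * Real.sqrt (Fintype.card n)) *
              (Real.sqrt (Fintype.card n) * ((C / ξ) * Real.exp (η * (C / ξ)))))
            (@basisConst κ _ (Matrix n n ℂ) Matrix.frobeniusNormedAddCommGroup Matrix.frobeniusNormedSpace e * (2 * Real.sqrt (Fintype.card n)) *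
              (Real.sqrt (Fintype.card n) * ((C / ξ ^ 2) * Real.exp (η * (C / ξ))))) * (1 + Fintype.card (J ⊕ J)) *
          Real.exp (-(δV * g.dist y y'))) ∧
      HasMaj (BlockNorm.ofBlocks g (blkPair (liftBlk blk κ))) (BlockNorm.ofBlocks g (liftBlk blk κ))
        (unstackM
          (curvCoefC η τ (fun μ x => coordMat e (ContinuousLinearMap.mulLeftRight ℝ (Matrix n n ℂ) (gaugeTr τ u V μ x : Matrix n n ℂ) (gaugeTr τ u V μ x : Matrix n n ℂ)ᴴ))
            (fun μ x => coordMat e (ContinuousLinearMap.mulLeftRight ℝ (Matrix n n ℂ) (fluct η (rotB u A') μ x : Matrix n n ℂ) (fluct η (rotB u A') μ x : Matrix n n ℂ)ᴴ)))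
          (curvCoefA η τ (fun μ x => coordMat e (ContinuousLinearMap.mulLeftRight ℝ (Matrix n n ℂ) (gaugeTr τ u V μ x : Matrix n n ℂ) (gaugeTr τ u V μ x : Matrix n n ℂ)ᴴ))
            (fun μ x => coordMat e (ContinuousLinearMap.mulLeftRight ℝ (Matrix n n ℂ) (fluct η (rotB u A') μ x : Matrix n n ℂ) (fluct η (rotB u A') μ x : Matrix n n ℂ)ᴴ))))
        (fun y y' => curvRowLetter κ J
            (@basisConst κ _ (Matrix n n ℂ) Matrix.frobeniusNormedAddCommGroup Matrix.frobeniusNormedSpace e * (2 * Real.sqrt (Fintype.card n)) *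
              (Real.sqrt (Fintype.card n) * ((α₁ / scaleLen L η j) * Real.exp (η * (α₁ / scaleLen L η j)))))
            (@basisConst κ _ (Matrix n n ℂ) Matrix.frobeniusNormedAddCommGroup Matrix.frobeniusNormedSpace e * (2 * Real.sqrt (Fintype.card n)) *
              (Real.sqrt (Fintype.card n) * ((α₁ / scaleLen L η j ^ 2) * Real.exp (η * (α₁ / scaleLen L η j))))) * (1 + Fintype.card (J ⊕ J)) *
          Real.exp (-(δV * g.dist y y'))) ∧
      prodCfg (gaugeTr τ u V) η (rotB u A') = gaugeTr τ u (prodCfg V η A') :=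
  uN_exists_gauge_hasMaj_pair_of_reg335Cube_cplx337_shape e τ V he blk hd0 hη hV hξ hC h (B9Eq335RegularityClasses.scaleLen_pos hL hη j) hα₁ hA
    (fun μ x => h37.1 j μ x (hΩ x)) (fun μ ν x => h37.2 j μ ν x (hΩ x)) δV

end Junction

end Summit.QuantumFields.YangMills.BalabanUVNodes.N15.CurvedSpecies

end
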